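import Literature.InformationTheory.QuantumCodes.HypergraphProductKernels
import Literature.InformationTheory.QuantumCodes.CSS
import Mathlib.LinearAlgebra.Basis.VectorSpace
import HarnessLib

/-!
# Sector (per-type) distance bounds of the hypergraph product — Zeng–Pryadko's Künneth formula, lower-bound half

For Tillich–Zémor's quantum code `Q_ℋ`, `ℋ = ℋ₁·ℋ₂` (`H_X = xMatrix H₁ H₂ = [H₁ ⊗ 1 | 1 ⊗ H₂]`,
`H_Z = zMatrix H₁ H₂ = [1 ⊗ H₂ᵀ | H₁ᵀ ⊗ 1]`, `Literature/InformationTheory/QuantumCodes/HypergraphProduct.lean`)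
Tillich–Zémor's Theorem 9 bounds the minimum distance by `min(d₁, d₂, d₁ᵀ, d₂ᵀ)` for BOTH types of logical
operators at once. The sharper, per-type ("sector") form is the length-two case of Zeng–Pryadko's Künneth theorem
with a distance [ZengPryadko2020, Thm 17 = §4.1 eq. on chunk p0015: `d_j(𝒜 × ℬ) = min_i d_i(𝒜) d_{j−i}(ℬ)` when
`ℬ` has two non-trivial spaces, with the convention (chunk p0010 L53) that the distance of a trivial homology group
is `∞`]: reading `Q_ℋ` as the product of the two-term complexes `𝔽₂^{E₁} →(H₁) 𝔽₂^{V₁}` and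
`𝔽₂^{E₂} →(H₂) 𝔽₂^{V₂}`,

* CYCLES (`Z`-type logical operators, `e ∈ ker H_X ∖ rowsp H_Z`): `|e| ≥ min(d(ker H₁), d(ker H₂))`
  (`cycle_weight_ge`), and if `ker H₁ᵀ = 0` (no homology in degree `0` of the first factor) then `|e| ≥ d(ker H₁)`
  outright (`cycle_weight_ge_of_transpose`) — the term `d₀(𝒜)·d₁(ℬ)` of the Künneth minimum is absent;
* COCYCLES (`X`-type, `e ∈ ker H_Z ∖ rowsp H_X`): `|e| ≥ min(d(ker H₁ᵀ), d(ker H₂ᵀ))` (`cocycle_weight_ge`), and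
  if `ker H₁ = 0` then `|e| ≥ d(ker H₁ᵀ)` (`cocycle_weight_ge_of_kernel`) — by Poincaré duality (TZ Prop. 2,
  `xMatrix_eq_submatrix_swap` / `zMatrix_eq_submatrix_swap`) from the cycle statements;
* consequence for the CSS minimum distance (`le_cssMinDist_of_transpose`): if `ker H₁ᵀ = 0` then
  `D(Q_ℋ) ≥ min(d(ker H₁), d(ker H₂ᵀ))` — NO dependence on `d(ker H₂)`. Under the dictionary
  `HGP(H₁, H₂) = Q_{ℋ₁·ℋ₂ᵀ}` of `Summits/Ventures/QEC/Basic/HypergraphProduct.lean` this reads: if the first seed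
  has full row rank then `D ≥ min(d₁, d₂)` regardless of `d₂ᵀ` (with TZ Lemma 10, `D = min(d₁, d₂)`), the case the
  blanket formula "`D = min(d₁, d₂, d₁ᵀ, d₂ᵀ)`" of the survey literature gets wrong when `d₂ᵀ < min(d₁, d₂)`.

PROOF (elementary linear algebra, ours; [ZengPryadko2020] argue via punctured / shortened subsystem codes): write a
cycle as `e = (M, N)` with `H₁ M = N H₂ᵀ` (`mem_pcCode_xMatrix_iff`). If fewer than `d(ker H₁)` rows of `M` are
nonzero, `H₁` is injective on vectors supported on those rows, so a linear left inverse `g` lifts the columns of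
`N` to a matrix `G` with `G H₂ᵀ = M`; subtracting the stabiliser `(G H₂ᵀ, H₁ G)` (`mem_rowSpace_zMatrix_iff`)
leaves `(0, N')` with `N' H₂ᵀ = 0`, every row of `N'` in `ker H₂`, and the nonzero columns of `N'` among those of
`N`; a nonzero row gives `|e| ≥ |N| ≥ d(ker H₂)`, and `N' = 0` would make `e` a stabiliser. If moreover `H₁` is
onto (`ker H₁ᵀ = 0`), a linear right inverse lifts `N'` itself, so `(0, N')` is a stabiliser — contradiction —
whence at least `d(ker H₁)` rows of `M` are nonzero. General reindexing lemmas (`pcCode` / `rowSpace` /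
`cssMinDist` under row relabelling) are recorded first. Everything is over `𝔽₂` = `ZMod 2` as in the rest of the
hypergraph-product files.
-/

namespace Literature.InformationTheory.QuantumCodes

open Matrix
open Literature.InformationTheory.Coding (minDist minDist_bot minDist_le_hammingNorm le_minDist_iff)

/-! ### Reindexing rows (relabelling checks changes neither the code nor the row space) -/

section ReindexRows

variable {F : Type*} [Field F] [DecidableEq F]
variable {r r' r₂ r₂' q : Type*} [Fintype r] [Fintype r'] [Fintype r₂] [Fintype r₂'] [Fintype q]

omit [DecidableEq F] [Fintype r] [Fintype r₂] in
/-- Relabelling the rows of a parity-check matrix along an equivalence does not change its code.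
[cite: TillichZemor2014, §2 and Prop. 2 (arXiv v1 chunks p0004 L9-18, p0006 L95-100: the code and its distance depend only on the check spaces; relabelled edge/check sets are identified)] -/
theorem pcCode_submatrix_equiv_rows (A : Matrix r q F) (ρ : r₂ ≃ r) : pcCode (A.submatrix ρ id) = pcCode A := by
  ext v
  simp only [mem_pcCode_iff]
  constructor
  · intro h
    funext i
    have := congrFun h (ρ.symm i)
    simpa [Matrix.mulVec, Matrix.submatrix_apply] using this
  · intro h
    funext i
    have := congrFun h (ρ i)
    simpa [Matrix.mulVec, Matrix.submatrix_apply] using this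

omit [DecidableEq F] [Fintype q] in
/-- Relabelling the rows along an equivalence does not change the row space.
[cite: TillichZemor2014, §2 and Prop. 2 (arXiv v1 chunks p0004 L9-18, p0006 L95-100: the code and its distance depend only on the check spaces; relabelled edge/check sets are identified)] -/
theorem rowSpace_submatrix_equiv_rows (A : Matrix r q F) (ρ : r₂ ≃ r) :
    rowSpace (A.submatrix ρ id) = rowSpace A := by
  ext v
  simp only [mem_rowSpace_iff]
  constructor
  · rintro ⟨y, rfl⟩
    refine ⟨y ∘ ρ.symm, ?_⟩
    rw [show A.submatrix (⇑ρ) id = A.submatrix ρ (Equiv.refl q) from rfl, Matrix.submatrix_vecMul_equiv]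
    rfl
  · rintro ⟨y, rfl⟩
    refine ⟨y ∘ ρ, ?_⟩
    rw [show A.submatrix (⇑ρ) id = A.submatrix ρ (Equiv.refl q) from rfl, Matrix.submatrix_vecMul_equiv]
    have hy : (y ∘ ρ) ∘ ρ.symm = y := by
      ext i
      simp
    rw [hy]
    rfl

/-- The CSS minimum distance is unchanged by relabelling the rows of the two check matrices.
[cite: TillichZemor2014, §2 and Prop. 2 (arXiv v1 chunks p0004 L9-18, p0006 L95-100: the code and its distance depend only on the check spaces; relabelled edge/check sets are identified)] -/
theorem cssMinDist_submatrix_equiv_rows (A : Matrix r q F) (B : Matrix r' q F) (ρ : r₂ ≃ r) (ρ' : r₂' ≃ r') :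
    cssMinDist (A.submatrix ρ id) (B.submatrix ρ' id) = cssMinDist A B := by
  simp only [cssMinDist, pcCode_submatrix_equiv_rows, rowSpace_submatrix_equiv_rows]

end ReindexRows

namespace HypergraphProduct

variable {V₁ E₁ V₂ E₂ : Type*}
variable [Fintype V₁] [Fintype E₁] [Fintype V₂] [Fintype E₂]
variable [DecidableEq V₁] [DecidableEq E₁] [DecidableEq V₂] [DecidableEq E₂]

/-! ### Arithmetic in characteristic two -/

omit [Fintype V₁] [Fintype E₁] [Fintype V₂] [Fintype E₂] [DecidableEq V₁] [DecidableEq E₁] [DecidableEq V₂]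
  [DecidableEq E₂] in
/-- In `𝔽₂`, `x + y = 0` forces `x = y`. [folklore] -/
private theorem zmod2_eq_of_add_eq_zero {x y : ZMod 2} (h : x + y = 0) : x = y := by
  revert x y h; decide

omit [Fintype V₁] [Fintype E₁] [Fintype V₂] [Fintype E₂] [DecidableEq V₁] [DecidableEq E₁] [DecidableEq V₂]
  [DecidableEq E₂] in
/-- In `𝔽₂`, `x + x = 0`. [folklore] -/
private theorem zmod2_add_self (x : ZMod 2) : x + x = 0 := by
  revert x; decide

/-! ### Supports of the two parts of an edge vector -/

omit [DecidableEq V₁] [DecidableEq V₂] [DecidableEq E₂] in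
/-- At most `|e|` rows of the `E_R`-part of an edge vector `e` are nonzero. [folklore] -/
private theorem card_rows_inl_le (e : (E₁ × V₂) ⊕ (V₁ × E₂) → ZMod 2) :
    ((Finset.univ.filter fun p : E₁ × V₂ => e (Sum.inl p) ≠ 0).image Prod.fst).card ≤ hammingNorm e := by
  classical
  refine Finset.card_image_le.trans ?_
  rw [← Finset.card_map ⟨Sum.inl, Sum.inl_injective⟩]
  refine Finset.card_le_card fun i hi => ?_
  rw [Finset.mem_map] at hi
  obtain ⟨p, hp, rfl⟩ := hi
  simpa using hp

omit [DecidableEq V₁] [DecidableEq E₁] [DecidableEq V₂] in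
/-- At most `|e|` columns of the `E_L`-part of an edge vector `e` are nonzero. [folklore] -/
private theorem card_cols_inr_le (e : (E₁ × V₂) ⊕ (V₁ × E₂) → ZMod 2) :
    ((Finset.univ.filter fun p : V₁ × E₂ => e (Sum.inr p) ≠ 0).image Prod.snd).card ≤ hammingNorm e := by
  classical
  refine Finset.card_image_le.trans ?_
  rw [← Finset.card_map ⟨Sum.inr, Sum.inr_injective⟩]
  refine Finset.card_le_card fun i hi => ?_
  rw [Finset.mem_map] at hi
  obtain ⟨p, hp, rfl⟩ := hi
  simpa using hp

/-- A vector vanishing outside `T` has weight at most `|T|`. [folklore] -/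
private theorem hammingNorm_le_card_of_subset {ι : Type*} [Fintype ι] [DecidableEq ι] (x : ι → ZMod 2) (T : Finset ι)
    (h : ∀ i, i ∉ T → x i = 0) : hammingNorm x ≤ T.card :=
  Finset.card_le_card fun i hi => by
    by_contra hiT
    exact (Finset.mem_filter.1 hi).2 (h i hiT)

/-! ### Linear lifts of columns -/

omit [Fintype V₁] [Fintype E₁] [Fintype V₂] [DecidableEq V₁] [DecidableEq E₁] [DecidableEq V₂] [DecidableEq E₂] in
/-- Lifting the columns of `N : V₁ × E₂` through a linear map `φ : 𝔽₂^{V₁} → 𝔽₂^{E₁}` commutes with right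
multiplication by `H₂ᵀ`: `(lift N) H₂ᵀ` has columns `φ` of the columns of `N H₂ᵀ`. [folklore] -/
private theorem lift_mul_transpose_apply (φ : (V₁ → ZMod 2) →ₗ[ZMod 2] (E₁ → ZMod 2)) (N : Matrix V₁ E₂ (ZMod 2))
    (H₂ : Matrix V₂ E₂ (ZMod 2)) (α : E₁) (v : V₂) :
    ((Matrix.of fun α' β => φ (fun a => N a β) α') * H₂ᵀ) α v = φ (fun a => (N * H₂ᵀ) a v) α := by
  have hcol : (fun a => (N * H₂ᵀ) a v) = ∑ β, (H₂ v β) • (fun a => N a β) := by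
    funext a
    simp [Matrix.mul_apply, Finset.sum_apply, mul_comm]
  rw [hcol, map_sum, Finset.sum_apply, Matrix.mul_apply]
  refine Finset.sum_congr rfl fun β _ => ?_
  rw [map_smul, Pi.smul_apply, smul_eq_mul, Matrix.of_apply, Matrix.transpose_apply, mul_comm]

omit [Fintype V₁] [Fintype V₂] [Fintype E₂] [DecidableEq V₁] [DecidableEq E₁] [DecidableEq V₂] [DecidableEq E₂] in
/-- Left multiplication by `H₁` of a column-lifted matrix is `H₁` applied to the lifted columns. [folklore] -/
private theorem mul_lift_apply (H₁ : Matrix V₁ E₁ (ZMod 2)) (φ : (V₁ → ZMod 2) →ₗ[ZMod 2] (E₁ → ZMod 2))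
    (N : Matrix V₁ E₂ (ZMod 2)) (a : V₁) (β : E₂) :
    (H₁ * Matrix.of fun α' β' => φ (fun a' => N a' β') α') a β = (H₁ *ᵥ φ (fun a' => N a' β)) a := by
  simp only [Matrix.mul_apply, Matrix.mulVec, dotProduct, Matrix.of_apply]

omit [Fintype V₁] [Fintype V₂] [Fintype E₂] [DecidableEq V₁] [DecidableEq V₂] [DecidableEq E₂] in
/-- **Injectivity of `H₁` below the distance.** If `|T| < d(ker H₁)` then `H₁` is injective on the vectors
supported on `T`, and (over the field `𝔽₂`) admits a linear map `g` inverting it there.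
[cite: ZengPryadko2020, §3 Lemma 2 (chunk p0010 L64-100: shortening below the distance)] -/
theorem exists_leftInv_on_support (H₁ : Matrix V₁ E₁ (ZMod 2)) (T : Finset E₁)
    (hT : (T.card : ℕ∞) < minDist (pcCode H₁)) :
    ∃ g : (V₁ → ZMod 2) →ₗ[ZMod 2] (E₁ → ZMod 2),
      ∀ x : E₁ → ZMod 2, (∀ α, α ∉ T → x α = 0) → g (H₁ *ᵥ x) = x := by
  let S : Submodule (ZMod 2) (E₁ → ZMod 2) := Submodule.pi ((↑T : Set E₁)ᶜ) fun _ => ⊥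
  have hS : ∀ x : E₁ → ZMod 2, x ∈ S ↔ ∀ α, α ∉ T → x α = 0 := fun x => by
    simp only [S, Submodule.mem_pi, Set.mem_compl_iff, Finset.mem_coe, Submodule.mem_bot]
  let f : S →ₗ[ZMod 2] (V₁ → ZMod 2) := H₁.mulVecLin.comp S.subtype
  have hf : LinearMap.ker f = ⊥ := by
    rw [LinearMap.ker_eq_bot']
    rintro ⟨x, hx⟩ hx0
    have hx0' : H₁ *ᵥ x = 0 := hx0
    by_contra hne
    have hne' : x ≠ 0 := fun h0 => hne (Subtype.ext h0)
    have h1 : minDist (pcCode H₁) ≤ hammingNorm x :=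
      minDist_le_hammingNorm ((mem_pcCode_iff _ _).2 hx0') hne'
    have h2 : hammingNorm x ≤ T.card := hammingNorm_le_card_of_subset x T ((hS x).1 hx)
    exact lt_irrefl _ (lt_of_le_of_lt (h1.trans (by exact_mod_cast h2)) hT)
  obtain ⟨g, hg⟩ := LinearMap.exists_leftInverse_of_injective f hf
  refine ⟨S.subtype.comp g, fun x hx => ?_⟩
  have := LinearMap.congr_fun hg ⟨x, (hS x).2 hx⟩
  have h := congrArg Subtype.val this
  simpa [f] using h

/-! ### The reduction of a light cycle -/

/-- **Reduction lemma.** Let `e = (M, N)` be a cycle of `ℋ₁·ℋ₂` outside the chamber code whose `E_R`-part is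
supported on a set `T` of fewer than `d(ker H₁)` rows. Then, modulo a sum of chambers, `e ≡ (0, N')` with `N' ≠ 0`, `N' H₂ᵀ = 0`,
`(0, N')` still outside the chamber code, and the nonzero columns of `N'` among the nonzero columns of `N`.
[cite: ZengPryadko2020, §4.3 Statements 15-16 (chunk p0017 L58-110: reduction to one block)] -/
theorem cycle_reduction (H₁ : Matrix V₁ E₁ (ZMod 2)) (H₂ : Matrix V₂ E₂ (ZMod 2))
    (e : (E₁ × V₂) ⊕ (V₁ × E₂) → ZMod 2) (he : e ∈ pcCode (xMatrix H₁ H₂))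
    (hne : e ∉ rowSpace (zMatrix H₁ H₂)) (T : Finset E₁) (hTe : ∀ α v, e (Sum.inl (α, v)) ≠ 0 → α ∈ T)
    (hT : (T.card : ℕ∞) < minDist (pcCode H₁)) :
    ∃ N : Matrix V₁ E₂ (ZMod 2), N ≠ 0 ∧ N * H₂ᵀ = 0 ∧ glue 0 N ∉ rowSpace (zMatrix H₁ H₂) ∧
      ∀ a β, N a β ≠ 0 → ∃ a', e (Sum.inr (a', β)) ≠ 0 := by
  obtain ⟨g, hg⟩ := exists_leftInv_on_support H₁ T hT
  -- the cycle equation `H₁ M = N H₂ᵀ`, entrywise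
  have hcyc : ∀ a v, (H₁ * partR e) a v = (partL e * H₂ᵀ) a v := fun a v => by
    have h := (mem_pcCode_xMatrix_iff H₁ H₂ e).1 he
    rw [← Matrix.ext_iff] at h
    have h' := h a v
    rw [Matrix.add_apply, Matrix.zero_apply] at h'
    exact zmod2_eq_of_add_eq_zero h'
  -- the columns of `M` are supported on `T`
  have hsupp : ∀ v α, α ∉ T → (fun α' => partR e α' v) α = 0 := fun v α hα => by
    by_contra h
    exact hα (hTe α v h)
  -- the coefficient matrix of chambers `G`: columns of `N` lifted through `g`
  set G : Matrix E₁ E₂ (ZMod 2) := Matrix.of fun α β => g (fun a => partL e a β) α with hGdef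
  have hG : partR e = G * H₂ᵀ := by
    ext α v
    rw [hGdef, lift_mul_transpose_apply]
    have hcol : (fun a => (partL e * H₂ᵀ) a v) = H₁ *ᵥ fun α' => partR e α' v := by
      funext a
      rw [← hcyc a v]
      simp only [Matrix.mul_apply, Matrix.mulVec, dotProduct]
    rw [hcol, hg _ (hsupp v)]
  set s : (E₁ × V₂) ⊕ (V₁ × E₂) → ZMod 2 := glue (G * H₂ᵀ) (H₁ * G) with hs
  have hs_mem : s ∈ rowSpace (zMatrix H₁ H₂) :=
    (mem_rowSpace_zMatrix_iff H₁ H₂ s).2 ⟨G, partR_glue _ _, partL_glue _ _⟩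
  set N : Matrix V₁ E₂ (ZMod 2) := partL e + H₁ * G with hN
  have he' : e + s = glue 0 N := by
    funext x
    rcases x with ⟨α, v⟩ | ⟨a, β⟩
    · change e (Sum.inl (α, v)) + s (Sum.inl (α, v)) = 0
      rw [hs, glue_inl, ← partR_apply e, hG]
      exact zmod2_add_self _
    · change e (Sum.inr (a, β)) + s (Sum.inr (a, β)) = N a β
      rw [hs, glue_inr, hN, Matrix.add_apply, partL_apply]
  refine ⟨N, ?_, ?_, ?_, ?_⟩
  · -- `N ≠ 0`, else `e = -s` is a sum of chambers
    intro hN0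
    apply hne
    have h0 : e + s = 0 := by
      rw [he', hN0]
      ext (⟨α, b⟩ | ⟨a, β⟩) <;> rfl
    rw [eq_neg_of_add_eq_zero_left h0]
    exact Submodule.neg_mem _ hs_mem
  · -- `N H₂ᵀ = 0` because `e + s` is again a cycle with zero `E_R`-part
    have hmem : e + s ∈ pcCode (xMatrix H₁ H₂) :=
      Submodule.add_mem _ he (rowSpace_zMatrix_le H₁ H₂ hs_mem)
    rw [he', mem_pcCode_xMatrix_iff, partR_glue, partL_glue, Matrix.mul_zero, zero_add] at hmem
    exact hmem
  · -- `(0, N)` is outside the chamber code, else so is `e`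
    intro hmem
    apply hne
    rw [eq_sub_of_add_eq he']
    exact Submodule.sub_mem _ hmem hs_mem
  · -- nonzero columns of `N` are nonzero columns of the `E_L`-part of `e`
    intro a β hNaβ
    by_contra hβ
    apply hNaβ
    have hcol0 : (fun a' => partL e a' β) = 0 := by
      funext a'
      rw [partL_apply, Pi.zero_apply]
      by_contra h
      exact hβ ⟨a', h⟩
    have hGcol : ∀ α, G α β = 0 := fun α => by
      rw [hGdef, Matrix.of_apply, hcol0, map_zero, Pi.zero_apply]
    rw [hN, Matrix.add_apply, Matrix.mul_apply, Finset.sum_eq_zero fun α _ => by rw [hGcol α, mul_zero],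
      add_zero]
    have := congrFun hcol0 a
    rwa [partL_apply] at this

/-! ### Cycle (Z-sector) bounds -/

/-- **Z-sector bound (cycles).** Every cycle of `ℋ₁·ℋ₂` that is not a sum of chambers has weight at least
`min(d(ker H₁), d(ker H₂))` — Zeng–Pryadko's `min(d₁(𝒜) d₀(ℬ), d₀(𝒜) d₁(ℬ))` with `d₀ ≥ 1`, a sharpening of
Tillich–Zémor's Theorem 9 on the `Z` side (no transpose codes enter). In the tree's convention `d(0) = ⊤` the
statement covers the degenerate cases. [cite: ZengPryadko2020, Thm 17 (chunk p0018 L1-12) and §4.1 (chunk p0015 L40-46)] -/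
theorem cycle_weight_ge (H₁ : Matrix V₁ E₁ (ZMod 2)) (H₂ : Matrix V₂ E₂ (ZMod 2))
    {e : (E₁ × V₂) ⊕ (V₁ × E₂) → ZMod 2} (he : e ∈ pcCode (xMatrix H₁ H₂))
    (hne : e ∉ rowSpace (zMatrix H₁ H₂)) :
    min (minDist (pcCode H₁)) (minDist (pcCode H₂)) ≤ (hammingNorm e : ℕ∞) := by
  classical
  set T : Finset E₁ := (Finset.univ.filter fun p : E₁ × V₂ => e (Sum.inl p) ≠ 0).image Prod.fst with hTdef
  have hTe : ∀ α v, e (Sum.inl (α, v)) ≠ 0 → α ∈ T := fun α v h =>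
    Finset.mem_image.2 ⟨(α, v), Finset.mem_filter.2 ⟨Finset.mem_univ _, h⟩, rfl⟩
  by_cases hT : minDist (pcCode H₁) ≤ (T.card : ℕ∞)
  · exact (min_le_left _ _).trans (hT.trans (by exact_mod_cast card_rows_inl_le e))
  · rw [not_le] at hT
    obtain ⟨N, hN0, hNH, -, hsup⟩ := cycle_reduction H₁ H₂ e he hne T hTe hT
    obtain ⟨a, β, haβ⟩ : ∃ a β, N a β ≠ 0 := by
      by_contra h
      simp only [not_exists, not_not] at h
      exact hN0 (Matrix.ext fun a β => h a β)
    have hrow_mem : N a ∈ pcCode H₂ := by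
      rw [mem_pcCode_iff]
      funext v
      have h := congrFun (congrFun hNH a) v
      rw [Matrix.mul_apply, Matrix.zero_apply] at h
      rw [Pi.zero_apply, ← h]
      simp only [Matrix.mulVec, dotProduct, Matrix.transpose_apply, mul_comm]
    have hrow_ne : N a ≠ 0 := fun h => haβ (by rw [h, Pi.zero_apply])
    have h1 : minDist (pcCode H₂) ≤ hammingNorm (N a) := minDist_le_hammingNorm hrow_mem hrow_ne
    have h2 : hammingNorm (N a) ≤
        ((Finset.univ.filter fun p : V₁ × E₂ => e (Sum.inr p) ≠ 0).image Prod.snd).card :=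
      hammingNorm_le_card_of_subset _ _ fun β hβ => by
        by_contra h
        obtain ⟨a', ha'⟩ := hsup a β h
        exact hβ (Finset.mem_image.2 ⟨(a', β), Finset.mem_filter.2 ⟨Finset.mem_univ _, ha'⟩, rfl⟩)
    exact (min_le_right _ _).trans (h1.trans (by exact_mod_cast h2.trans (card_cols_inr_le e)))

omit [Fintype V₂] [Fintype E₂] [DecidableEq V₁] [DecidableEq E₁] [DecidableEq V₂] [DecidableEq E₂] in
/-- `H₁` is onto (as a map `𝔽₂^{E₁} → 𝔽₂^{V₁}`) when its transpose code is zero. [folklore] -/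
private theorem range_mulVecLin_eq_top_of_transpose (H₁ : Matrix V₁ E₁ (ZMod 2)) (h : pcCode H₁ᵀ = ⊥) :
    LinearMap.range H₁.mulVecLin = ⊤ := by
  apply Submodule.eq_top_of_finrank_eq
  rw [Module.finrank_fintype_fun_eq_card]
  have hr := rank_add_finrank_pcCode H₁ᵀ
  rw [h, finrank_bot, add_zero, Matrix.rank_transpose] at hr
  exact hr

/-- **Z-sector bound, first factor onto.** If `ker H₁ᵀ = 0` (the first factor has no homology in degree `0`:
`d₀(𝒜) = ∞`), every cycle outside the chamber code has weight at least `d(ker H₁)` — independently of `H₂`.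
[cite: ZengPryadko2020, Thm 17 (chunk p0018 L1-12), the term `d₀(𝒜)·d₁(ℬ)` being infinite] -/
theorem cycle_weight_ge_of_transpose (H₁ : Matrix V₁ E₁ (ZMod 2)) (H₂ : Matrix V₂ E₂ (ZMod 2))
    (h1 : pcCode H₁ᵀ = ⊥) {e : (E₁ × V₂) ⊕ (V₁ × E₂) → ZMod 2} (he : e ∈ pcCode (xMatrix H₁ H₂))
    (hne : e ∉ rowSpace (zMatrix H₁ H₂)) :
    minDist (pcCode H₁) ≤ (hammingNorm e : ℕ∞) := by
  classical
  set T : Finset E₁ := (Finset.univ.filter fun p : E₁ × V₂ => e (Sum.inl p) ≠ 0).image Prod.fst with hTdef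
  have hTe : ∀ α v, e (Sum.inl (α, v)) ≠ 0 → α ∈ T := fun α v h =>
    Finset.mem_image.2 ⟨(α, v), Finset.mem_filter.2 ⟨Finset.mem_univ _, h⟩, rfl⟩
  by_cases hT : minDist (pcCode H₁) ≤ (T.card : ℕ∞)
  · exact hT.trans (by exact_mod_cast card_rows_inl_le e)
  · exfalso
    rw [not_le] at hT
    obtain ⟨N, -, hNH, hnot, -⟩ := cycle_reduction H₁ H₂ e he hne T hTe hT
    obtain ⟨g', hg'⟩ :=
      LinearMap.exists_rightInverse_of_surjective H₁.mulVecLin (range_mulVecLin_eq_top_of_transpose H₁ h1)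
    set G' : Matrix E₁ E₂ (ZMod 2) := Matrix.of fun α β => g' (fun a => N a β) α with hG'
    have hL : H₁ * G' = N := by
      ext a β
      rw [hG', mul_lift_apply]
      have h := LinearMap.congr_fun hg' (fun a' => N a' β)
      simp only [LinearMap.comp_apply, Matrix.mulVecLin_apply, LinearMap.id_apply] at h
      rw [h]
    have hR : G' * H₂ᵀ = 0 := by
      ext α v
      rw [hG', lift_mul_transpose_apply, Matrix.zero_apply, hNH]
      have : (fun a : V₁ => (0 : Matrix V₁ V₂ (ZMod 2)) a v) = 0 := rfl
      rw [this, map_zero, Pi.zero_apply]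
    exact hnot ((mem_rowSpace_zMatrix_iff H₁ H₂ _).2 ⟨G', by rw [partR_glue, hR], by rw [partL_glue, hL]⟩)

/-! ### Cocycle (X-sector) bounds, by Poincaré duality -/

/-- **X-sector bound (cocycles).** Every cocycle of `ℋ₁·ℋ₂` that is not a sum of elementary cocycles has weight at
least `min(d(ker H₁ᵀ), d(ker H₂ᵀ))`. (TZ Prop. 2: cocycles of `ℋ₁·ℋ₂` are the cycles of `ℋ₁ᵀ·ℋ₂ᵀ`.)
[cite: ZengPryadko2020, Thm 17 (chunk p0018 L1-12), applied to the co-chain complex] -/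
theorem cocycle_weight_ge (H₁ : Matrix V₁ E₁ (ZMod 2)) (H₂ : Matrix V₂ E₂ (ZMod 2))
    {e : (E₁ × V₂) ⊕ (V₁ × E₂) → ZMod 2} (he : e ∈ pcCode (zMatrix H₁ H₂))
    (hne : e ∉ rowSpace (xMatrix H₁ H₂)) :
    min (minDist (pcCode H₁ᵀ)) (minDist (pcCode H₂ᵀ)) ≤ (hammingNorm e : ℕ∞) := by
  rw [zMatrix_eq_submatrix_swap,
    show (Sum.swap : (E₁ × V₂) ⊕ (V₁ × E₂) → (V₁ × E₂) ⊕ (E₁ × V₂)) = swapEquiv V₁ E₁ V₂ E₂ from rfl,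
    mem_pcCode_submatrix_iff] at he
  rw [xMatrix_eq_submatrix_swap,
    show (Sum.swap : (E₁ × V₂) ⊕ (V₁ × E₂) → (V₁ × E₂) ⊕ (E₁ × V₂)) = swapEquiv V₁ E₁ V₂ E₂ from rfl,
    mem_rowSpace_submatrix_iff] at hne
  have h := cycle_weight_ge H₁ᵀ H₂ᵀ he hne
  rwa [hammingNorm_comp_equiv] at h

/-- **X-sector bound, first factor injective.** If `ker H₁ = 0`, every cocycle outside the row space of `H_X` has
weight at least `d(ker H₁ᵀ)`. [cite: ZengPryadko2020, Thm 17 (chunk p0018 L1-12)] -/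
theorem cocycle_weight_ge_of_kernel (H₁ : Matrix V₁ E₁ (ZMod 2)) (H₂ : Matrix V₂ E₂ (ZMod 2))
    (h1 : pcCode H₁ = ⊥) {e : (E₁ × V₂) ⊕ (V₁ × E₂) → ZMod 2} (he : e ∈ pcCode (zMatrix H₁ H₂))
    (hne : e ∉ rowSpace (xMatrix H₁ H₂)) :
    minDist (pcCode H₁ᵀ) ≤ (hammingNorm e : ℕ∞) := by
  rw [zMatrix_eq_submatrix_swap,
    show (Sum.swap : (E₁ × V₂) ⊕ (V₁ × E₂) → (V₁ × E₂) ⊕ (E₁ × V₂)) = swapEquiv V₁ E₁ V₂ E₂ from rfl,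
    mem_pcCode_submatrix_iff] at he
  rw [xMatrix_eq_submatrix_swap,
    show (Sum.swap : (E₁ × V₂) ⊕ (V₁ × E₂) → (V₁ × E₂) ⊕ (E₁ × V₂)) = swapEquiv V₁ E₁ V₂ E₂ from rfl,
    mem_rowSpace_submatrix_iff] at hne
  have h1' : pcCode H₁ᵀᵀ = ⊥ := by rwa [Matrix.transpose_transpose]
  have h := cycle_weight_ge_of_transpose H₁ᵀ H₂ᵀ h1' he hne
  rwa [hammingNorm_comp_equiv] at h

/-! ### Consequences for the CSS minimum distance -/

/-- **Sector form of TZ Theorem 9.** `D(Q_ℋ) ≥ min( min(d(ker H₁), d(ker H₂)), min(d(ker H₁ᵀ), d(ker H₂ᵀ)) )` —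
the same number as Tillich–Zémor's `min(d₁, d₂, d₁ᵀ, d₂ᵀ)`, obtained here sector by sector.
[cite: ZengPryadko2020, Thm 17 (chunk p0018 L1-12)] [cite: TillichZemor2014, Thm 9 (arXiv v1 chunk p0008 L11-15)] -/
theorem le_cssMinDist_sector (H₁ : Matrix V₁ E₁ (ZMod 2)) (H₂ : Matrix V₂ E₂ (ZMod 2)) :
    min (min (minDist (pcCode H₁)) (minDist (pcCode H₂)))
        (min (minDist (pcCode H₁ᵀ)) (minDist (pcCode H₂ᵀ)))
      ≤ cssMinDist (xMatrix H₁ H₂) (zMatrix H₁ H₂) := by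
  refine le_cssMinDist_iff.2 fun e he => ?_
  rcases he with ⟨he, hne⟩ | ⟨he, hne⟩
  · exact (min_le_left _ _).trans (cycle_weight_ge H₁ H₂ he hne)
  · exact (min_le_right _ _).trans (cocycle_weight_ge H₁ H₂ he hne)

/-- **First factor onto: `D(Q_ℋ) ≥ min(d(ker H₁), d(ker H₂ᵀ))`.** If `ker H₁ᵀ = 0` then the `Z`-sector is bounded
by `d(ker H₁)` alone and the `X`-sector by `min(d(ker H₁ᵀ), d(ker H₂ᵀ)) = d(ker H₂ᵀ)`; the distance `d(ker H₂)`
does not enter. Under `HGP(H₁,H₂) = Q_{ℋ₁·ℋ₂ᵀ}`: a first seed of full row rank gives `D ≥ min(d₁, d₂)`.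
[cite: ZengPryadko2020, Thm 17 (chunk p0018 L1-12)] -/
theorem le_cssMinDist_of_transpose (H₁ : Matrix V₁ E₁ (ZMod 2)) (H₂ : Matrix V₂ E₂ (ZMod 2))
    (h1 : pcCode H₁ᵀ = ⊥) :
    min (minDist (pcCode H₁)) (minDist (pcCode H₂ᵀ)) ≤ cssMinDist (xMatrix H₁ H₂) (zMatrix H₁ H₂) := by
  refine le_cssMinDist_iff.2 fun e he => ?_
  rcases he with ⟨he, hne⟩ | ⟨he, hne⟩
  · exact (min_le_left _ _).trans (cycle_weight_ge_of_transpose H₁ H₂ h1 he hne)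
  · have h := cocycle_weight_ge H₁ H₂ he hne
    rw [h1, minDist_bot, min_top_left] at h
    exact (min_le_right _ _).trans h

end HypergraphProduct

end Literature.InformationTheory.QuantumCodes
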